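import Literature.Analysis.FluidPDE.SolenoidalL2Duality
import Literature.Analysis.FluidPDE.LerayProjectorFourierTools
import HarnessLib

/-!
# Helmholtz–Weyl `(L²_σ)ᗮ = G` on the whole space and the symbol of the Leray projector (discharges)

This file discharges the named fact `Literature.Analysis.FluidPDE.orthogonal_solenoidalL2_eq_gradientRange`
of `Literature/Analysis/FluidPDE/LerayProjector.lean` (Temam 1977, Ch. I, Thm. 1.4 and Rem. 1.6):
on a finite-dimensional real inner product space `E` with its Lebesgue measure, the orthogonal
complement in `L²(E; E)` of the solenoidal space `L²_σ(E)` (the `L²` closure of the smooth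
compactly supported divergence-free fields `𝒱`) is the space `G(E)` of `L²` gradients, defined
in the tree as the `L²` closure of the span of `{∇q | q ∈ C_c^∞(E; ℝ)}`
(`Literature.Analysis.FluidPDE.gradientRange`).

It lives in a sibling file because the proof uses `SolenoidalL2Duality.lean`, which imports
`LerayProjector.lean`.

## The printed statement and proof

Temam (1977, Ch. I §1.4, Thm. 1.4 with Rem. 1.6) proves `L²(Ω)ⁿ = H ⊕ H^⊥` with `H^⊥` the `L²`
gradients. For `Ω = ℝⁿ` the statement in exactly the vendored form is Sohr (2001), Ch. II §2.5:
Lemma 2.5.1, (2.5.3)/(2.5.8): `G(Ω) = L²_σ(Ω)^⊥` for every domain, and Lemma 2.5.4, (2.5.13):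
`G(ℝⁿ)` is the `L²` closure of `∇C₀^∞(ℝⁿ)`, together with (2.5.11):
`L²_σ(ℝⁿ) = {f ∈ L² : div f = 0}`. Sohr derives (2.5.11) from (2.5.8) and (2.5.13) by the
Hilbert-space identity `G^⊥ = (L²_σ)^⊥⊥ = L²_σ` (proof of Lemma 2.5.4, last paragraph). The tree
already has (2.5.11) **proved** (`Literature.Analysis.FluidPDE.mem_solenoidalL2_iff_holds`,
via the annihilator lemma of `HelmholtzAnnihilator.lean`), so here we run that last paragraph in
the converse direction:

* `gradientRange_le_orthogonal_solenoidalL2`: `G ≤ (L²_σ)ᗮ` — a generator `[∇q]` is orthogonal to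
  every `u ∈ L²_σ` since `⟪u, [∇q]⟫ = ∫ ⟪u, ∇q⟫ = 0` (`u` is weakly divergence free,
  `isWeaklyDivFree_of_mem_solenoidalL2`), and `(L²_σ)ᗮ` is closed;
* `orthogonal_gradientRange_le_solenoidalL2`: `Gᗮ ≤ L²_σ` — a field orthogonal to all `[∇q]` is
  weakly divergence free, hence in `L²_σ` by `mem_solenoidalL2_iff_holds`;
* `orthogonal_solenoidalL2_eq_gradientRange_holds`: taking orthogonal complements,
  `(L²_σ)ᗮ ≤ Gᗮᗮ = closure G = G` (Mathlib `Submodule.orthogonal_orthogonal_eq_closure`).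

No dimension hypothesis is needed (Sohr assumes `n ≥ 2`; in dimensions `0` and `1` both sides are
still equal, and the tree's `mem_solenoidalL2_iff_holds` is dimension-free).

## The symbol of the Leray projector (appended)

The second part of the file discharges the named fact
`Literature.Analysis.FluidPDE.fourier_lerayProjector_schwartz` of `LerayProjector.lean`
(Lemarié-Rieusset 2002, Ch. 11; Lemarié-Rieusset 2016, §6.3, Def. 6.4 with the remark that for
`F₀ ∈ L²` the Leray projection `ℙF₀` is the orthogonal projection onto `L²_σ`, and Prop. 6.2,
`ℙ = Id − ∇Δ⁻¹ div`, i.e. the Fourier multiplier `I − ξ ⊗ ξ/|ξ|²`): for `v ∈ L²(E; E)` with a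
test-function representative `φ` and every `w ∈ E`, the `L²` Fourier transform of the
complexified component `x ↦ (⟪w, (ℙv)(x)⟫ : ℂ)` is, for a.e. `ξ`, the Fourier integral at `ξ` of
`x ↦ ⟪w, P̂(ξ) φ(x)⟫` (`fourier_lerayProjector_schwartz_holds`). Architecture of the proof:

1. Helmholtz (first part of this file): `v = ℙv + g` with `ℙv ∈ L²_σ`, `g ∈ (L²_σ)ᗮ = G`.
2. `L²_σ` is transversal on the Fourier side, `Σᵢ ξᵢ 𝓕((ℙv)ᵢ)(ξ) = 0` a.e.
   (`ae_sum_inner_mul_fourier_eq_zero_of_mem_solenoidalL2`): true on `𝒱` (`𝓕(div φ) = 0`) and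
   the constraint is the kernel of a continuous linear map `L²(E; E) → L²(E; ℂ)` (bounded
   weights `ξᵢ/(1 + |ξ|²)`, Hölder and Plancherel), hence closed
   (`ae_sum_inner_mul_fourier_eq_zero_of_mem_topologicalClosure`, `LerayProjectorFourierTools`).
3. `G` is longitudinal on the Fourier side, `ξⱼ 𝓕(gᵢ) = ξᵢ 𝓕(gⱼ)` a.e.
   (`ae_inner_mul_fourier_comm_of_mem_gradientRange`): true on test gradients
   (`𝓕(∂ᵢq) = 2πi ξᵢ q̂`), closed by the same principle.
4. Pointwise algebra at a.e. frequency `ξ ≠ 0`: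
   `|ξ|² 𝓕(⟪w, g⟫) = ⟪ξ, w⟫ Σᵢ ξᵢ 𝓕(gᵢ) = ⟪ξ, w⟫ Σᵢ ξᵢ φ̂ᵢ`, so
   `𝓕(⟪w, ℙv⟫)(ξ) = 𝓕(⟪w, φ⟫)(ξ) − |ξ|⁻²⟪ξ, w⟫ Σᵢ ξᵢ φ̂ᵢ(ξ) = 𝓕(⟪w, P̂(ξ)φ⟫)(ξ)`.

Mathlib (pin `v4.32.0`) supplies the `L²` Fourier transform as a linear isometry equivalence
extending the Schwartz Fourier transform (`MeasureTheory.Lp.fourierTransformₗᵢ`,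
`SchwartzMap.toLp_fourier_eq`) and `SchwartzMap.fourier_lineDerivOp_eq`; it has no Leray
projector or Riesz transforms.

## References

* R. Temam, *Navier–Stokes Equations. Theory and Numerical Analysis* (North-Holland, 1977),
  Ch. I, §1.4, Thm. 1.4 and Rem. 1.6. Bib key `Temam1977`.
* H. Sohr, *The Navier–Stokes Equations. An Elementary Functional Analytic Approach*
  (Birkhäuser, 2001), Ch. II, §2.5, Lemma 2.5.1 ((2.5.3), (2.5.8)) and Lemma 2.5.4
  ((2.5.11)–(2.5.13)), pp. 81–86. Bib key `Sohr2001`.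
* P. G. Lemarié-Rieusset, *The Navier–Stokes Problem in the 21st Century* (CRC Press, 2016),
  §6.3, Def. 6.4, the remark following it, and Prop. 6.2. Bib key `LemarieRieusset2016`.
* P. G. Lemarié-Rieusset, *Recent developments in the Navier–Stokes problem* (Chapman &
  Hall/CRC, 2002), Ch. 11. Bib key `LemarieRieusset2002`.
-/

noncomputable section

open MeasureTheory TopologicalSpace
open scoped RealInnerProductSpace ENNReal

namespace Literature.Analysis.FluidPDE

variable {E : Type*} [NormedAddCommGroup E] [InnerProductSpace ℝ E] [FiniteDimensional ℝ E]
  [MeasurableSpace E] [BorelSpace E]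

/-- The gradient of a real test function is in `L²(E; E)` (continuous with compact support).
[folklore] -/
theorem memLp_two_gradient_of_isTestFunctionOn {q : E → ℝ}
    (hq : FunctionSpaces.IsTestFunctionOn (⊤ : Opens E) q) :
    MemLp (gradient q) 2 (volume : Measure E) := by
  have hgc : Continuous (gradient q) :=
    (InnerProductSpace.toDual ℝ E).symm.continuous.comp (hq.contDiff.continuous_fderiv (by simp))
  have hgs : HasCompactSupport (gradient q) :=
    (hq.hasCompactSupport.fderiv (𝕜 := ℝ)).comp_left (g := (InnerProductSpace.toDual ℝ E).symm)
      (map_zero _)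
  exact hgc.memLp_of_hasCompactSupport hgs

/-- The `L²` pairing with the class of a test gradient is the integral pairing with the gradient:
`⟪w, [∇q]⟫ = ∫ ⟪w, ∇q⟫`. [folklore] -/
theorem inner_toLp_gradient_eq_integral {q : E → ℝ}
    (hq : FunctionSpaces.IsTestFunctionOn (⊤ : Opens E) q) (w : Lp E 2 (volume : Measure E)) :
    ⟪w, (memLp_two_gradient_of_isTestFunctionOn hq).toLp (gradient q)⟫ =
      ∫ x, ⟪(w : E → E) x, gradient q x⟫ := by
  rw [L2.inner_def]
  refine integral_congr_ae ?_
  filter_upwards [(memLp_two_gradient_of_isTestFunctionOn hq).coeFn_toLp] with x hx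
  rw [hx]

/-- The class `[∇q]` of a test gradient lies in the gradient space `G(E)` (it is one of its
generators; Temam 1977, Ch. I Rem. 1.6; Sohr 2001, Ch. II (2.5.12)–(2.5.13)). [cite: Sohr2001, Ch. II Lemma 2.5.4 (2.5.13)] -/
theorem toLp_gradient_mem_gradientRange {q : E → ℝ}
    (hq : FunctionSpaces.IsTestFunctionOn (⊤ : Opens E) q) :
    (memLp_two_gradient_of_isTestFunctionOn hq).toLp (gradient q) ∈ gradientRange E := by
  rw [gradientRange]
  exact Submodule.le_topologicalClosure _
    (Submodule.subset_span ⟨q, hq, (memLp_two_gradient_of_isTestFunctionOn hq).coeFn_toLp⟩)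

/-- **`G ≤ (L²_σ)ᗮ`**: the `L²` gradients are orthogonal to the solenoidal space (Temam 1977,
Ch. I Thm. 1.4 / Rem. 1.6; Sohr 2001, Ch. II Lemma 2.5.1, the inclusion `G(Ω) ⊆ L²_σ(Ω)^⊥` in the
proof of (2.5.8): `⟪∇p, v⟫ = -⟪p, div v⟫ = 0` on `𝒱`, then by density on `L²_σ`). Here: each
generator `[∇q]` is orthogonal to every `u ∈ L²_σ` because `u` is weakly divergence free
(`isWeaklyDivFree_of_mem_solenoidalL2`), and `(L²_σ)ᗮ` is a closed subspace. [cite: Sohr2001, Ch. II Lemma 2.5.1 (2.5.8)] -/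
theorem gradientRange_le_orthogonal_solenoidalL2 : gradientRange E ≤ (solenoidalL2 E)ᗮ := by
  rw [gradientRange]
  refine Submodule.topologicalClosure_minimal _ ?_ (Submodule.isClosed_orthogonal _)
  rw [Submodule.span_le]
  rintro v ⟨q, hq, hv⟩
  rw [SetLike.mem_coe, Submodule.mem_orthogonal]
  intro u hu
  have hdiv : IsWeaklyDivFree ((u : Lp E 2 (volume : Measure E)) : E → E) :=
    isWeaklyDivFree_of_mem_solenoidalL2 hu
  rw [← hdiv q hq, L2.inner_def]
  refine integral_congr_ae ?_
  filter_upwards [hv] with x hx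
  rw [hx]

/-- **`Gᗮ ≤ L²_σ`**: an `L²` field orthogonal to all gradients of test functions is weakly
divergence free (`⟪w, [∇q]⟫ = ∫ ⟪w, ∇q⟫ = 0`), hence lies in `L²_σ` by the proved
characterisation `L²_σ(ℝⁿ) = {f ∈ L² : div f = 0}` (`mem_solenoidalL2_iff_holds`; Sohr 2001,
Ch. II Lemma 2.5.4 (2.5.11); Temam 1977, Ch. I Thm. 1.4 with Rem. 1.6). [cite: Sohr2001, Ch. II Lemma 2.5.4 (2.5.11)] -/
theorem orthogonal_gradientRange_le_solenoidalL2 : (gradientRange E)ᗮ ≤ solenoidalL2 E := by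
  intro w hw
  refine (mem_solenoidalL2_iff_holds w).2 fun q hq => ?_
  rw [← inner_toLp_gradient_eq_integral hq w]
  exact Submodule.inner_left_of_mem_orthogonal (toLp_gradient_mem_gradientRange hq) hw

/-- **Discharge** of `orthogonal_solenoidalL2_eq_gradientRange` (**Helmholtz–Weyl decomposition on
the whole space**, Temam 1977, Ch. I Thm. 1.4 and Rem. 1.6; in the vendored form Sohr 2001, Ch. II,
Lemma 2.5.1 (2.5.8) `G = (L²_σ)^⊥` with Lemma 2.5.4 (2.5.13) `G(ℝⁿ) = closure ∇C₀^∞(ℝⁿ)`):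
`(L²_σ(E))ᗮ = G(E)`. Proof: `G ≤ (L²_σ)ᗮ` is `gradientRange_le_orthogonal_solenoidalL2`; conversely,
from `Gᗮ ≤ L²_σ` (`orthogonal_gradientRange_le_solenoidalL2`) we get
`(L²_σ)ᗮ ≤ Gᗮᗮ = closure G = G`, the Hilbert-space step `G^⊥ = (L²_σ)^⊥⊥ = L²_σ` of Sohr's proof of
(2.5.11) run backwards (Mathlib `Submodule.orthogonal_orthogonal_eq_closure`). [cite: Temam1977, Ch. I Thm. 1.4 and Rem. 1.6] -/
theorem orthogonal_solenoidalL2_eq_gradientRange_holds :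
    orthogonal_solenoidalL2_eq_gradientRange (E := E) := by
  refine le_antisymm ?_ gradientRange_le_orthogonal_solenoidalL2
  have hclosed : IsClosed (gradientRange E : Set (Lp E 2 (volume : Measure E))) := by
    rw [gradientRange]
    exact Submodule.isClosed_topologicalClosure _
  calc (solenoidalL2 E)ᗮ ≤ (gradientRange E)ᗮᗮ :=
        Submodule.orthogonal_le orthogonal_gradientRange_le_solenoidalL2
    _ = (gradientRange E).topologicalClosure := Submodule.orthogonal_orthogonal_eq_closure _
    _ = gradientRange E := hclosed.submodule_topologicalClosure_eq

end Literature.Analysis.FluidPDE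


/-! ## The symbol of the Leray projector -/

open Filter FourierTransform
open scoped InnerProductSpace SchwartzMap LineDeriv Real

namespace Literature.Analysis.FluidPDE

variable {E : Type*} [NormedAddCommGroup E] [InnerProductSpace ℝ E] [FiniteDimensional ℝ E]
  [MeasurableSpace E] [BorelSpace E]

/-! ### `L²_σ` is transversal and `G` is longitudinal on the Fourier side -/

/-- **`L²_σ` is transversal on the Fourier side** (`ξ · û(ξ) = 0`): for `u ∈ L²_σ(E)` and an
orthonormal frame `b`, `Σᵢ ⟪ξ, bᵢ⟫ 𝓕(⟪bᵢ, u⟫)(ξ) = 0` for a.e. `ξ`, where `𝓕(⟪bᵢ, u⟫)` is the `L²`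
Fourier transform of the complexified component. For `u ∈ 𝒱` this is `𝓕(div φ) = 0`
(`sum_inner_mul_fourier_eq_zero_of_isDivFree`); it passes to the closure `L²_σ` of `span 𝒱` by
`ae_sum_inner_mul_fourier_eq_zero_of_mem_topologicalClosure` (Lemarié-Rieusset 2016, §6.3:
`L²_σ` = divergence-free square-integrable fields). [cite: LemarieRieusset2016, §6.3 Def. 6.4 and remark] -/
theorem ae_sum_inner_mul_fourier_eq_zero_of_mem_solenoidalL2 {ι : Type*} [Fintype ι]
    (b : OrthonormalBasis ι ℝ E) {u : Lp E 2 (volume : Measure E)} (hu : u ∈ solenoidalL2 E) :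
    ∀ᵐ ξ ∂(volume : Measure E), ∑ i, ((⟪ξ, b i⟫ : ℝ) : ℂ) *
      ((Lp.fourierTransformₗᵢ E ℂ ((Complex.ofRealCLM.comp (innerSL ℝ (b i))).compLp u) :
        Lp ℂ 2 (volume : Measure E)) : E → ℂ) ξ = 0 := by
  refine ae_sum_inner_mul_fourier_eq_zero_of_mem_topologicalClosure (⇑b) (⇑b)
    (S := smoothSolenoidal E) (fun v hv => ?_) hu
  obtain ⟨φ, hφ, hφd, hvφ⟩ := hv
  choose ψ hψ using fun i => exists_schwartzMap_coe_eq_inner hφ (b i)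
  have hT : ∀ i, ((Lp.fourierTransformₗᵢ E ℂ ((Complex.ofRealCLM.comp (innerSL ℝ (b i))).compLp v) :
      Lp ℂ 2 (volume : Measure E)) : E → ℂ) =ᵐ[volume] (𝓕 (ψ i) : 𝓢(E, ℂ)) := fun i =>
    coeFn_fourierTransform_compLp_of_ae_eq (ψ i)
      (by filter_upwards [hvφ] with x hx; rw [hx, hψ])
  filter_upwards [ae_all_iff.2 hT] with ξ hξ
  rw [Finset.sum_congr rfl fun i _ => by rw [hξ i]]
  exact sum_inner_mul_fourier_eq_zero_of_isDivFree b (hφ.contDiff.differentiable (by simp)) hφd ψ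
    hψ ξ

/-- **`L²` gradients are longitudinal on the Fourier side** (`ĝ(ξ) ∥ ξ`): for `g ∈ G(E)` and
`w, w' ∈ E`, `⟪ξ, w'⟫ 𝓕(⟪w, g⟫)(ξ) = ⟪ξ, w⟫ 𝓕(⟪w', g⟫)(ξ)` for a.e. `ξ`. For a test gradient
`g = ∇q` this is `𝓕(∂_w q)(ξ) = 2πi ⟪ξ, w⟫ q̂(ξ)` (`inner_gradient_eq_lineDerivOp`,
`fourier_lineDerivOp_apply`); it passes to the closure `G` by
`ae_sum_inner_mul_fourier_eq_zero_of_mem_topologicalClosure` (Lemarié-Rieusset 2016, §6.3: the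
irrotational part `H = ∇p` of the Helmholtz decomposition). [cite: LemarieRieusset2016, §6.3 Def. 6.4 and remark] -/
theorem ae_inner_mul_fourier_comm_of_mem_gradientRange {g : Lp E 2 (volume : Measure E)}
    (hg : g ∈ gradientRange E) (w w' : E) :
    ∀ᵐ ξ ∂(volume : Measure E), ((⟪ξ, w'⟫ : ℝ) : ℂ) *
      ((Lp.fourierTransformₗᵢ E ℂ ((Complex.ofRealCLM.comp (innerSL ℝ w)).compLp g) :
        Lp ℂ 2 (volume : Measure E)) : E → ℂ) ξ =
      ((⟪ξ, w⟫ : ℝ) : ℂ) *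
      ((Lp.fourierTransformₗᵢ E ℂ ((Complex.ofRealCLM.comp (innerSL ℝ w')).compLp g) :
        Lp ℂ 2 (volume : Measure E)) : E → ℂ) ξ := by
  have h := ae_sum_inner_mul_fourier_eq_zero_of_mem_topologicalClosure (κ := Fin 2)
    ![w', -w] ![w, w']
    (S := {v : Lp E 2 (volume : Measure E) | ∃ q : E → ℝ,
      FunctionSpaces.IsTestFunctionOn (⊤ : Opens E) q ∧ (v : E → E) =ᵐ[volume] gradient q})
    (fun v hv => ?_) hg
  · filter_upwards [h] with ξ hξ
    simp only [Fin.sum_univ_two, Matrix.cons_val_zero, Matrix.cons_val_one,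
      Matrix.cons_val_fin_one, inner_neg_right, Complex.ofReal_neg, neg_mul] at hξ
    rwa [← sub_eq_add_neg, sub_eq_zero] at hξ
  · obtain ⟨q, hq, hvq⟩ := hv
    obtain ⟨Q, hQ⟩ := exists_schwartzMap_coe_eq_ofReal hq
    have hT : ∀ a : E, ((Lp.fourierTransformₗᵢ E ℂ
        ((Complex.ofRealCLM.comp (innerSL ℝ a)).compLp v) : Lp ℂ 2 (volume : Measure E)) :
          E → ℂ) =ᵐ[volume] (𝓕 (∂_{a} Q) : 𝓢(E, ℂ)) := fun a =>
      coeFn_fourierTransform_compLp_of_ae_eq (∂_{a} Q)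
        (by
          filter_upwards [hvq] with x hx
          rw [hx, inner_gradient_eq_lineDerivOp (hq.contDiff.differentiable (by simp)) hQ])
    filter_upwards [hT w, hT w'] with ξ h1 h2
    simp only [Fin.sum_univ_two, Matrix.cons_val_zero, Matrix.cons_val_one,
      Matrix.cons_val_fin_one]
    rw [h1, h2, fourier_lineDerivOp_apply, fourier_lineDerivOp_apply, inner_neg_right]
    push_cast
    ring

/-! ### The symbol of the Leray projector -/

/-- **Discharge of `fourier_lerayProjector_schwartz`: the Leray projector is the Fourier
multiplier `P̂(ξ) = I − ξ ⊗ ξ/|ξ|²`** (Lemarié-Rieusset 2002, Ch. 11; Lemarié-Rieusset 2016,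
§6.3, Def. 6.4 with the remark that `ℙ` is the orthogonal projection of `L²` onto `L²_σ`, and
Prop. 6.2). For `v ∈ L²(E; E)` with a test-function representative `φ` and `w ∈ E`, the `L²`
Fourier transform of `x ↦ (⟪w, (ℙv)(x)⟫ : ℂ)` is a.e. the Fourier integral at `ξ` of
`x ↦ ⟪w, P̂(ξ) φ(x)⟫`. Proof: write `v = ℙv + g` with `ℙv ∈ L²_σ` and `g ∈ (L²_σ)ᗮ = G`
(Helmholtz, `orthogonal_solenoidalL2_eq_gradientRange_holds`). On the Fourier side `ℙv` is
transversal (`ae_sum_inner_mul_fourier_eq_zero_of_mem_solenoidalL2`) and `g` is longitudinal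
(`ae_inner_mul_fourier_comm_of_mem_gradientRange`), so for a.e. `ξ`:
`|ξ|² 𝓕(⟪w, g⟫) = ⟪ξ, w⟫ Σᵢ ξᵢ 𝓕(gᵢ) = ⟪ξ, w⟫ Σᵢ ξᵢ 𝓕(vᵢ) = ⟪ξ, w⟫ Σᵢ ξᵢ φ̂ᵢ`, i.e.
`𝓕(⟪w, ℙv⟫)(ξ) = 𝓕(⟪w, φ⟫)(ξ) − |ξ|⁻² ⟪ξ, w⟫ Σᵢ ξᵢ φ̂ᵢ(ξ) = 𝓕(⟪w, P̂(ξ)φ⟫)(ξ)` for `ξ ≠ 0`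
(a null set when `E ≠ 0`; for `E = 0` both sides vanish as `w = 0`). [cite: LemarieRieusset2016, §6.3 Def. 6.4 with remark and Prop. 6.2] -/
theorem fourier_lerayProjector_schwartz_holds : fourier_lerayProjector_schwartz (E := E) := by
  intro v φ hφ hv w
  rcases subsingleton_or_nontrivial E with hE | hE
  · -- `E = 0`: `w = 0` and both sides vanish
    have hw : w = 0 := Subsingleton.elim _ _
    subst hw
    have hL := coeFn_fourierTransform_compLp_of_ae_eq (u := lerayProjector E v) (w := (0 : E))
      (0 : 𝓢(E, ℂ)) (Eventually.of_forall fun x => by simp)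
    filter_upwards [hL] with ξ hξ
    rw [hξ, FourierTransform.fourier_zero, zero_apply]
    simp [Real.fourier_eq]
  -- Schwartz representatives of the components of `φ`
  set b := stdOrthonormalBasis ℝ E with hb
  obtain ⟨ψw, hψw⟩ := exists_schwartzMap_coe_eq_inner hφ w
  choose ψ hψ using fun i => exists_schwartzMap_coe_eq_inner hφ (b i)
  -- Helmholtz: `v = u + g`, `u = ℙ v ∈ L²_σ`, `g ∈ G`
  set u : Lp E 2 (volume : Measure E) := lerayProjector E v with hu_def
  set g : Lp E 2 (volume : Measure E) := v - u with hg_def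
  have hu : u ∈ solenoidalL2 E := lerayProjector_apply_mem v
  have hg : g ∈ gradientRange E := by
    rw [← orthogonal_solenoidalL2_eq_gradientRange_holds]
    exact Submodule.sub_starProjection_mem_orthogonal v
  have hvug : v = u + g := by rw [hg_def, add_sub_cancel]
  -- additivity of the component Fourier transforms
  have hadd : ∀ a : E, ∀ᵐ ξ ∂(volume : Measure E),
      ((Lp.fourierTransformₗᵢ E ℂ ((Complex.ofRealCLM.comp (innerSL ℝ a)).compLp v) :
        Lp ℂ 2 (volume : Measure E)) : E → ℂ) ξ =
      ((Lp.fourierTransformₗᵢ E ℂ ((Complex.ofRealCLM.comp (innerSL ℝ a)).compLp u) :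
        Lp ℂ 2 (volume : Measure E)) : E → ℂ) ξ +
      ((Lp.fourierTransformₗᵢ E ℂ ((Complex.ofRealCLM.comp (innerSL ℝ a)).compLp g) :
        Lp ℂ 2 (volume : Measure E)) : E → ℂ) ξ := by
    intro a
    have h1 : (Complex.ofRealCLM.comp (innerSL ℝ a)).compLp v =
        (Complex.ofRealCLM.comp (innerSL ℝ a)).compLp u +
          (Complex.ofRealCLM.comp (innerSL ℝ a)).compLp g := by
      rw [hvug]
      exact ((Complex.ofRealCLM.comp (innerSL ℝ a)).compLpL 2 (volume : Measure E)).map_add u g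
    rw [h1, map_add]
    filter_upwards [Lp.coeFn_add
      (Lp.fourierTransformₗᵢ E ℂ ((Complex.ofRealCLM.comp (innerSL ℝ a)).compLp u))
      (Lp.fourierTransformₗᵢ E ℂ ((Complex.ofRealCLM.comp (innerSL ℝ a)).compLp g))] with ξ hξ
    rw [hξ, Pi.add_apply]
  -- the Fourier-side facts, a.e. in `ξ`
  have h1 := ae_sum_inner_mul_fourier_eq_zero_of_mem_solenoidalL2 b hu
  have h2 := ae_all_iff.2 fun i => ae_inner_mul_fourier_comm_of_mem_gradientRange hg (b i) w
  have h3 := hadd w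
  have h4 := ae_all_iff.2 fun i => hadd (b i)
  have h5 := coeFn_fourierTransform_compLp_of_ae_eq (u := v) ψw
    (by filter_upwards [hv] with x hx; rw [hx, hψw])
  have h6 := ae_all_iff.2 fun i => coeFn_fourierTransform_compLp_of_ae_eq (u := v) (ψ i)
    (by filter_upwards [hv] with x hx; rw [hx, hψ])
  have h7 : ∀ᵐ ξ ∂(volume : Measure E), ξ ≠ 0 := by
    rw [ae_iff]
    simp
  filter_upwards [h1, h2, h3, h4, h5, h6, h7] with ξ h1 h2 h3 h4 h5 h6 h7
  rw [fourier_inner_leraySymbol_eq b w ξ hψw hψ]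
  -- scalar bookkeeping at the frequency `ξ`
  set S : ℂ := ∑ i, ((⟪ξ, b i⟫ : ℝ) : ℂ) * 𝓕 (ψ i) ξ with hS
  set Tg : E → ℂ := fun a => ((Lp.fourierTransformₗᵢ E ℂ
    ((Complex.ofRealCLM.comp (innerSL ℝ a)).compLp g) : Lp ℂ 2 (volume : Measure E)) : E → ℂ) ξ
    with hTg_def
  set Tu : E → ℂ := fun a => ((Lp.fourierTransformₗᵢ E ℂ
    ((Complex.ofRealCLM.comp (innerSL ℝ a)).compLp u) : Lp ℂ 2 (volume : Measure E)) : E → ℂ) ξ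
    with hTu_def
  have hSg : ∑ i, ((⟪ξ, b i⟫ : ℝ) : ℂ) * Tg (b i) = S := by
    have : ∑ i, ((⟪ξ, b i⟫ : ℝ) : ℂ) * Tg (b i) =
        ∑ i, ((⟪ξ, b i⟫ : ℝ) : ℂ) * 𝓕 (ψ i) ξ - ∑ i, ((⟪ξ, b i⟫ : ℝ) : ℂ) * Tu (b i) := by
      rw [← Finset.sum_sub_distrib]
      refine Finset.sum_congr rfl fun i _ => ?_
      rw [← h6 i, h4 i]
      ring
    rw [this, h1, sub_zero]
  have hnorm : ((‖ξ‖ ^ 2 : ℝ) : ℂ) = ∑ i, ((⟪ξ, b i⟫ : ℝ) : ℂ) * ((⟪ξ, b i⟫ : ℝ) : ℂ) := by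
    have : ‖ξ‖ ^ 2 = ∑ i, ⟪ξ, b i⟫ * ⟪ξ, b i⟫ := by
      rw [← real_inner_self_eq_norm_sq, ← b.sum_inner_mul_inner ξ ξ]
      exact Finset.sum_congr rfl fun i _ => by rw [real_inner_comm (b i) ξ]
    rw [this]
    push_cast
    rfl
  have hTg : ((‖ξ‖ ^ 2 : ℝ) : ℂ) * Tg w = ((⟪ξ, w⟫ : ℝ) : ℂ) * S := by
    rw [hnorm, Finset.sum_mul, ← hSg, Finset.mul_sum]
    refine Finset.sum_congr rfl fun i _ => ?_
    rw [mul_assoc, ← h2 i]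
    ring
  have hξ : ((‖ξ‖ ^ 2 : ℝ) : ℂ) ≠ 0 :=
    Complex.ofReal_ne_zero.2 (pow_ne_zero 2 (norm_ne_zero_iff.2 h7))
  have hTg' : Tg w = ((‖ξ‖ ^ 2 : ℝ) : ℂ)⁻¹ * (((⟪ξ, w⟫ : ℝ) : ℂ) * S) := by
    rw [← hTg, ← mul_assoc, inv_mul_cancel₀ hξ, one_mul]
  have hTu : Tu w = 𝓕 ψw ξ - Tg w := by
    rw [← h5, h3]
    ring
  change Tu w = _
  rw [hTu, hTg', real_inner_comm ξ w]
  push_cast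
  ring

end Literature.Analysis.FluidPDE
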